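/-
Copyright (c) 2026 the pub-hodgecm-mathlib formalisation cell (harness21).  Prover seat hodgecm-mathlib-LH10-p01 (g3): line LH4 (dyadic pay-down of `stub_N6nsDyadic`),
organ (D-SH), brick (R-dy) «RAO REGULAR CLASS AT A DYADIC PLACE», FILE 3 (LH4-plan (g3) DEALER WORDS #1∕#2); the proof is ★ p849481's (LH5-p02 (g2)) with the `ord 2`
bookkeeping threaded through; 2026-09-02.
-/
import Literature.NumberTheory.Automorphic.UnitaryThreeRegularUnipotentOrbitFrameDyadic        -- ★ p850047 FILE 1 (this seat): `…transversal_of_le`, `…scalarRegCent'`, `exists_valued_v_two_eq_exp`; brings ★ p849366 (A2)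
import Literature.NumberTheory.Rogawski1990.UnipotentOrbitCoveringRegularAllCM               -- ★ p850048 FILE 2 (this seat): (I′) `UnitaryGroup.exists_cover_of_regular_basePoint'`
import Literature.NumberTheory.Automorphic.ValuationBallStableSubgroupIndex              -- ★ p849305 (LH5-p02): ball-index growth `relIndex_mul_pow_two_le`, skew↔fixed transfer
import Literature.NumberTheory.Rogawski1990.UnipotentLevelPiecesFrameCM                  -- ★ p846498: the `ψ` dictionary
import Literature.NumberTheory.Automorphic.LocalUnitaryIntegralLevel                     -- ★ `placeForm_antidiagOne`
import Literature.NumberTheory.Automorphic.UnitaryThreeSingularUnipotentClasses           -- ★ `exists_units_coe_eq_torusElt`, `torusElt_mem_unitaryGroupOfForm`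
import Literature.NumberTheory.Automorphic.UnitaryGroupInertPlaceHyperbolicBasis          -- ★ `galAdicCompletionMap_galAdicCompletionMap_of_smul_eq`
import Literature.NumberTheory.Automorphic.AdicCompletionCompact                         -- ★ `finite_residueField_adicCompletion`
import Literature.NumberTheory.Rogawski1990.UnipotentOrbitalIntegralConvergenceTransvectionCM  -- ★ p849314 (F0P3a-p09): carrier instances + `ψ`-dictionary idioms
import Literature.NumberTheory.Rogawski1990.UnipotentOrbitCentralizerBallsCM            -- ★ p849437 (LH7-p03), part (II-S): `UnitaryGroup.exists_centralizerBall`, `UnitaryGroup.relIndex_centralizerBall_eq` (no `2`)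
import Literature.NumberTheory.Rogawski1990.UnipotentOrbitShellsRegularCM                -- ★ p849481 (LH5-p02), part (II): `exists_rep_of_relIndex_ne_zero` (§1, pure group theory) — the odd-place file this one generalises
import HarnessLib

/-!
# The LEVEL SHELLS of a REGULAR unipotent orbit of `U(Φ₃)(L⁺_v)` at an ARBITRARY non-split place, dyadic included (Ranga Rao 1972; Rogawski 1990 §3.9, §8.1):
# shell count against centraliser growth with the `ord 2` shift

Topic `NumberTheory/Rogawski1990`; namespace `Literature.NumberTheory.Rogawski1990` (`UnitaryGroup.` prefix on the carrier heads).  THEOREMS ONLY (no definition, no instance,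
no notation, no named fact, no `sorry`); kernel lane `--supports stmt-HodgeConjecture-24833`.  Cell `pub/hodgecm-mathlib` (D-0151), crux H413 = `stmt-HodgeConjecture-24833`;
half A line LH4, the DYADIC pay-down of the closer row `stub_N6nsDyadic` (LH4-plan (g3), skeleton v1 0447f09394670f4b), organ (D-SH) «Shalika at `Φ₃` at dyadic non-split
places», brick (R-dy) «RAO REGULAR CLASS AT A DYADIC PLACE», FILE 3 of 4 (seat LH10-p01 (g3); census `DYADIC-CENSUS.v1.md` §6 (LH4-p02 (g2))).  This is ★ (II) p849481
`UnipotentOrbitShellsRegularCM` (LH5-p02 (g2)) with its ONE essential hypothesis `2 ∈ 𝒪_w^×` removed; the SEVEN conclusion clauses are byte-identical (★ (B) p849341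
`measure_biUnion_image_mk_mul_lt_top_of_shells'` consumes them unchanged).

THE MATHEMATICS (the `ord 2` shift; everything else = ★ (II)).  `v 2 = exp(−c₂)`, `c₂ = ord_w 2 ≥ 0`.  From ★ (I′) `y = k·y₁`, `ψy₁ = d^j m_κ n(a,s)`, `−R₁ ≤ j`,
`v(t₀ + 2κξ) ≤ exp(R₂ + 2j)`; hence `v(κξ) = exp(c₂)·v(2κξ) ≤ exp(r′ + 2j)` with `r′ = max(R₂, τ − 2j₀, −j₀) + c₂` (`v t₀ ≤ exp τ`, `j₀ = min(−R₁, 0)`).  COSET CRITERION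
(★ FILE 1 `isIntMatrix_torusZpow_conj_transversal_of_le`): `d^j m_{κ′} d^{−j} ∈ K_U` as soon as `v(κ′ξ) ≤ exp(j − c₂)` — so the representatives `κ_q` of level `j` are taken
modulo `B_F(j − e − 2c₂)` (even shift: `2c₂ ≥ c₂`), `N_j = [B_F(r′ + 2j − e) : B_F(j − e − 2c₂)] = [B_F(r₂ + 2j − e₂) : B_F(j − e₂)]` with `e₂ := e + 2c₂`, `r₂ := r′ + 2c₂` —
EXACTLY the shape of ★ BALL-INDEX `relIndex_mul_pow_two_le` at `(e, r) := (e₂, r₂)`.  Accordingly the level subgroups are `S_j = C(γ₀) ∩ ψ⁻¹(Z(U)·B_{exp(−r′), exp(2j − 2c₂)})`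
(`s`-radius shrunk by `2c₂`, so that `[S_j : S_{j₀}] = [B_F(2j − e₂) : B_F(2j₀ − e₂)]` after the skew→fixed transfer), and the ABSORPTION `K_G x_{j,q} S_j ⊆ K_G x_{j,q}` is ★ FILE 1
`isIntMatrix_torusZpow_conj_transversal_conj_scalarRegCent'` with `nₐ = r′`, `−j + c₂ ≤ r′` (the `a`-radius pays for `v(a²∕2) = v(a)² exp(c₂)`).  GROWTH, COMPACTNESS,
MONOTONICITY and COVERING then read as in ★ (II), with the constant `c₃ = [B_F(r₂ + 2j₀ − e₂) : B_F(2j₀ − e₂)]`.  Inert, ramified, odd and dyadic places alike.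

* §1 **`UnitaryGroup.exists_shells_of_regular_unipotent_of_cover'`** — the seven shell clauses from (I′) and (II-S) taken as hypotheses, `v 2 = exp(−c₂)`.
* §2 **`UnitaryGroup.exists_shells_of_regular_unipotent'`** — THE EXPORT at every non-split place: ★ (II) `…_of_regular_unipotent`'s text with the binder `h2` deleted.

## References
* [Rao1972] R. Ranga Rao, *Orbital integrals in reductive groups*, Ann. of Math. (2) 96 (1972) 505–510, Theorem (p. 505).
* [Rogawski1990] J. D. Rogawski, *Automorphic Representations of Unitary Groups in Three Variables*, Ann. of Math. Stud. 123 (1990), §3.9 p. 32; §4.9 p. 54; §8.1 p. 112.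
* [HarishChandra1999AdmissibleDistributions] Harish-Chandra, *Admissible Invariant Distributions on Reductive p-adic Groups*, AMS ULS 16 (1999), §3.1 p. 17.
-/

set_option autoImplicit false

noncomputable section

open scoped Matrix MatrixGroups Valued WithZero Pointwise
open NumberField IsDedekindDomain Matrix

namespace Literature.NumberTheory.Rogawski1990

open Literature.NumberTheory.Automorphic Literature.NumberTheory.Automorphic.UnitaryGroup Literature.NumberTheory.GaloisRepresentations
open Literature.NumberTheory.Automorphic.HermitianLattice Literature.NumberTheory.Automorphic.UnitaryLatticeTree

/-! ## §1 The shells of the regular orbit from the covering and the centraliser balls, `v 2 = exp(−c₂)` -/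

set_option maxHeartbeats 1600000 in
-- measured: the default 200 000 heartbeats time out on the final `group` normalisations of the covering clause
/-- = ★ `UnitaryGroup.exists_shells_of_regular_unipotent_of_cover` with the hypothesis `2 ∈ 𝒪_w^×` (`v 2 = 1`) deleted (replaced by the VALUE `v 2 = exp(−c₂)`,
`c₂ : ℕ`; conclusion byte-identical).  **THE LEVEL SHELLS OF A REGULAR UNIPOTENT ORBIT OF `U(Φ₃)(L⁺_v)` AT ANY RESIDUE CHARACTERISTIC — from the COVERING (I′) and the
CENTRALISER BALLS (II-S).**  Base point `γ₀` with `ψγ₀ = u(1, −t₀)`,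
torus `d = diag(z, 1, (σz)⁻¹)` (`v z = exp(−1)`), skew `ξ ≠ 0`; given the Iwasawa covering of `{y | yγ₀y⁻¹ ∈ C}` by `K_G·ψ⁻¹(d^j m_κ n(a,s))` (`hcov`, (I)) and the open
centraliser ball subgroups with their index (`hballs`, `hrel`, (II-S)): there are levels `j ≥ j₀`, finitely many shells `K_G·x_{j,q}` per level (`q < N j`, `x_{j,q} = ψ⁻¹(d^j m_{κ_q})`,
`κ_q` representatives of `B_F(r′+2j−e) ⁄ B_F(j−e−2c₂)` on the fixed line `F`), compact open level subgroups `S_j` of `C(γ₀)` ABSORBED by the shells (`K_G x S_j ⊆ K_G x`), whose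
index GROWS at least like `2^{⌊(j−2j₀)∕2⌋}` against the shell count, and the shells COVER the orbit-preimage of `C`.  The seven clauses are exactly the hypotheses of ★
`measure_biUnion_image_mk_mul_lt_top_of_shells` (p849341). [cite: Rao1972, Theorem p. 505] [cite: Rogawski1990, §3.9 p. 32; §8.1 p. 112] -/
theorem UnitaryGroup.exists_shells_of_regular_unipotent_of_cover'
    (L : Type) [Field L] [NumberField L] [IsCMField L] (v : HeightOneSpectrum (𝓞 ↥(maximalRealSubfield L)))
    (w : PlacesOver L v) (hw : IsCMField.complexConj L • w.1 = w.1) {c₂ : ℕ} (hv2 : Valued.v (2 : (w.1.adicCompletion L)) = WithZero.exp (-(c₂ : ℤ)))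
    {z ξ t₀ : (w.1.adicCompletion L)} (hz : Valued.v z = WithZero.exp (-1 : ℤ)) (hξ : (galAdicCompletionMap (L := L) (IsCMField.complexConj L) hw) ξ = -ξ) (hξ0 : ξ ≠ 0)
    {d : GL (Fin 3) (w.1.adicCompletion L)} (hd : (d : Matrix (Fin 3) (Fin 3) (w.1.adicCompletion L)) = Matrix.diagonal ![z, 1, ((galAdicCompletionMap (L := L) (IsCMField.complexConj L) hw) z)⁻¹])
    (γ₀ : ((cmDatum L 3 (Matrix.of fun i j : Fin 3 => if i.val + j.val + 1 = 3 then (1 : L) else 0)).Local v)) (hγ₀ : (((localNonsplitEquiv (IsCMField.complexConj L) (Matrix.of fun i j : Fin 3 => if i.val + j.val + 1 = 3 then (1 : L) else 0) (IsCMField.complexConj_ne_one L) w hw γ₀ : ↥(unitaryGroupOfForm (galAdicCompletionMap (L := L) (IsCMField.complexConj L) hw) (placeForm (Matrix.of fun i j : Fin 3 => if i.val + j.val + 1 = 3 then (1 : L) else 0) w.1))) : GL (Fin 3) (w.1.adicCompletion L)) : Matrix (Fin 3) (Fin 3) (w.1.adicCompletion L)) = !![1, 1, -t₀; 0, 1,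 -1; 0, 0, 1])
    (hcov : ∀ C : Set ((cmDatum L 3 (Matrix.of fun i j : Fin 3 => if i.val + j.val + 1 = 3 then (1 : L) else 0)).Local v), IsCompact C → ∃ R₁ R₂ : ℤ, ∀ y : ((cmDatum L 3 (Matrix.of fun i j : Fin 3 => if i.val + j.val + 1 = 3 then (1 : L) else 0)).Local v), y * γ₀ * y⁻¹ ∈ C →
      ∃ (k y₁ : ((cmDatum L 3 (Matrix.of fun i j : Fin 3 => if i.val + j.val + 1 = 3 then (1 : L) else 0)).Local v)) (j : ℤ) (κ a s : (w.1.adicCompletion L)) (m n : GL (Fin 3) (w.1.adicCompletion L)), k ∈ (cmLocalIntegralLevel L 3 (Matrix.of fun i j : Fin 3 => if i.val + j.val + 1 = 3 then (1 : L) else 0) v) ∧ y = k * y₁ ∧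
        ((localNonsplitEquiv (IsCMField.complexConj L) (Matrix.of fun i j : Fin 3 => if i.val + j.val + 1 = 3 then (1 : L) else 0) (IsCMField.complexConj_ne_one L) w hw y₁ : ↥(unitaryGroupOfForm (galAdicCompletionMap (L := L) (IsCMField.complexConj L) hw) (placeForm (Matrix.of fun i j : Fin 3 => if i.val + j.val + 1 = 3 then (1 : L) else 0) w.1))) : GL (Fin 3) (w.1.adicCompletion L)) = d ^ j * m * n ∧ (m : Matrix (Fin 3) (Fin 3) (w.1.adicCompletion L)) = !![1, κ * ξ, κ ^ 2 * ξ ^ 2 / 2; 0, 1, κ * ξ; 0, 0, 1] ∧ (n : Matrix (Fin 3) (Fin 3) (w.1.adicCompletion L)) = !![1, a, s - a ^ 2 / 2; 0, 1, -a; 0, 0, 1] ∧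
        (galAdicCompletionMap (L := L) (IsCMField.complexConj L) hw) κ = κ ∧ (galAdicCompletionMap (L := L) (IsCMField.complexConj L) hw) a = a ∧ (galAdicCompletionMap (L := L) (IsCMField.complexConj L) hw) s = -s ∧ -R₁ ≤ j ∧ Valued.v (t₀ + 2 * κ * ξ) ≤ WithZero.exp (R₂ + 2 * j))
    (hballs : ∀ ra r : ℤᵐ⁰, ra ≠ 0 → r ≠ 0 → ∃ S : Subgroup ↥(Subgroup.centralizer (({γ₀} : Set ((cmDatum L 3 (Matrix.of fun i j : Fin 3 => if i.val + j.val + 1 = 3 then (1 : L) else 0)).Local v)))),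
      (∀ h : ↥(Subgroup.centralizer (({γ₀} : Set ((cmDatum L 3 (Matrix.of fun i j : Fin 3 => if i.val + j.val + 1 = 3 then (1 : L) else 0)).Local v)))), h ∈ S ↔ ∃ ζ a s : (w.1.adicCompletion L), (galAdicCompletionMap (L := L) (IsCMField.complexConj L) hw) ζ * ζ = 1 ∧ (galAdicCompletionMap (L := L) (IsCMField.complexConj L) hw) a = a ∧ (galAdicCompletionMap (L := L) (IsCMField.complexConj L) hw) s = -s ∧ Valued.v a ≤ ra ∧ Valued.v s ≤ r ∧
        ((((localNonsplitEquiv (IsCMField.complexConj L) (Matrix.of fun i j : Fin 3 => if i.val + j.val + 1 = 3 then (1 : L) else 0) (IsCMField.complexConj_ne_one L) w hw (h : ((cmDatum L 3 (Matrix.of fun i j : Fin 3 => if i.val + j.val + 1 = 3 then (1 : L) else 0)).Local v)) : ↥(unitaryGroupOfForm (galAdicCompletionMap (L := L) (IsCMField.complexConj L) hw) (placeForm (Matrix.of fun i j : Fin 3 => if i.val + j.val + 1 = 3 then (1 : L) else 0) w.1))) : GL (Fin 3) (w.1.adicCompletion L)) : Matrix (Fin 3) (Fin 3) (w.1.adicCompletion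 L)) = ζ • !![1, a, s - a ^ 2 / 2; 0, 1, -a; 0, 0, 1])) ∧ IsOpen (S : Set ↥(Subgroup.centralizer (({γ₀} : Set ((cmDatum L 3 (Matrix.of fun i j : Fin 3 => if i.val + j.val + 1 = 3 then (1 : L) else 0)).Local v))))))
    (hrel : ∀ {ra r r' : ℤᵐ⁰} {S S' : Subgroup ↥(Subgroup.centralizer (({γ₀} : Set ((cmDatum L 3 (Matrix.of fun i j : Fin 3 => if i.val + j.val + 1 = 3 then (1 : L) else 0)).Local v))))},
      (∀ h : ↥(Subgroup.centralizer (({γ₀} : Set ((cmDatum L 3 (Matrix.of fun i j : Fin 3 => if i.val + j.val + 1 = 3 then (1 : L) else 0)).Local v)))), h ∈ S ↔ ∃ ζ a s : (w.1.adicCompletion L), (galAdicCompletionMap (L := L) (IsCMField.complexConj L) hw) ζ * ζ = 1 ∧ (galAdicCompletionMap (L := L) (IsCMField.complexConj L) hw) a = a ∧ (galAdicCompletionMap (L := L) (IsCMField.complexConj L) hw) s = -s ∧ Valued.v a ≤ ra ∧ Valued.v s ≤ r ∧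
        ((((localNonsplitEquiv (IsCMField.complexConj L) (Matrix.of fun i j : Fin 3 => if i.val + j.val + 1 = 3 then (1 : L) else 0) (IsCMField.complexConj_ne_one L) w hw (h : ((cmDatum L 3 (Matrix.of fun i j : Fin 3 => if i.val + j.val + 1 = 3 then (1 : L) else 0)).Local v)) : ↥(unitaryGroupOfForm (galAdicCompletionMap (L := L) (IsCMField.complexConj L) hw) (placeForm (Matrix.of fun i j : Fin 3 => if i.val + j.val + 1 = 3 then (1 : L) else 0) w.1))) : GL (Fin 3) (w.1.adicCompletion L)) : Matrix (Fin 3) (Fin 3) (w.1.adicCompletion L)) = ζ • !![1, a, s - a ^ 2 / 2; 0, 1, -a; 0, 0, 1])) →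
      (∀ h : ↥(Subgroup.centralizer (({γ₀} : Set ((cmDatum L 3 (Matrix.of fun i j : Fin 3 => if i.val + j.val + 1 = 3 then (1 : L) else 0)).Local v)))), h ∈ S' ↔ ∃ ζ a s : (w.1.adicCompletion L), (galAdicCompletionMap (L := L) (IsCMField.complexConj L) hw) ζ * ζ = 1 ∧ (galAdicCompletionMap (L := L) (IsCMField.complexConj L) hw) a = a ∧ (galAdicCompletionMap (L := L) (IsCMField.complexConj L) hw) s = -s ∧ Valued.v a ≤ ra ∧ Valued.v s ≤ r' ∧
        ((((localNonsplitEquiv (IsCMField.complexConj L) (Matrix.of fun i j : Fin 3 => if i.val + j.val + 1 = 3 then (1 : L) else 0) (IsCMField.complexConj_ne_one L) w hw (h : ((cmDatum L 3 (Matrix.of fun i j : Fin 3 => if i.val + j.val + 1 = 3 then (1 : L) else 0)).Local v)) : ↥(unitaryGroupOfForm (galAdicCompletionMap (L := L) (IsCMField.complexConj L) hw) (placeForm (Matrix.of fun i j : Fin 3 => if i.val + j.val + 1 = 3 then (1 : L) else 0) w.1))) : GL (Fin 3) (w.1.adicCompletion L)) : Matrix (Fin 3) (Fin 3) (w.1.adicCompletion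 L)) = ζ • !![1, a, s - a ^ 2 / 2; 0, 1, -a; 0, 0, 1])) →
      S.relIndex S' = ((Valued.v : Valuation (w.1.adicCompletion L) ℤᵐ⁰).leAddSubgroup r ⊓ (AddMonoidHom.id (w.1.adicCompletion L) + ((galAdicCompletionMap (L := L) (IsCMField.complexConj L) hw) : (w.1.adicCompletion L) →+* (w.1.adicCompletion L)).toAddMonoidHom).ker).relIndex ((Valued.v : Valuation (w.1.adicCompletion L) ℤᵐ⁰).leAddSubgroup r' ⊓ (AddMonoidHom.id (w.1.adicCompletion L) + ((galAdicCompletionMap (L := L) (IsCMField.complexConj L) hw) : (w.1.adicCompletion L) →+* (w.1.adicCompletion L)).toAddMonoidHom).ker))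
    (C : Set ((cmDatum L 3 (Matrix.of fun i j : Fin 3 => if i.val + j.val + 1 = 3 then (1 : L) else 0)).Local v)) (hC : IsCompact C) :
    ∃ (j₀ : ℤ) (N : ℤ → ℕ) (x : ℤ → ℕ → ((cmDatum L 3 (Matrix.of fun i j : Fin 3 => if i.val + j.val + 1 = 3 then (1 : L) else 0)).Local v)) (S : ℤ → Subgroup ↥(Subgroup.centralizer (({γ₀} : Set ((cmDatum L 3 (Matrix.of fun i j : Fin 3 => if i.val + j.val + 1 = 3 then (1 : L) else 0)).Local v))))) (c₃ : ℕ),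
      j₀ ≤ 0 ∧ 0 < c₃ ∧ (∀ j, j₀ ≤ j → IsCompact (S j : Set ↥(Subgroup.centralizer (({γ₀} : Set ((cmDatum L 3 (Matrix.of fun i j : Fin 3 => if i.val + j.val + 1 = 3 then (1 : L) else 0)).Local v)))))) ∧ IsOpen (S j₀ : Set ↥(Subgroup.centralizer (({γ₀} : Set ((cmDatum L 3 (Matrix.of fun i j : Fin 3 => if i.val + j.val + 1 = 3 then (1 : L) else 0)).Local v))))) ∧ (∀ j, j₀ ≤ j → S j₀ ≤ S j) ∧
      (∀ j, j₀ ≤ j → ∀ q, q < N j → ∀ k ∈ (cmLocalIntegralLevel L 3 (Matrix.of fun i j : Fin 3 => if i.val + j.val + 1 = 3 then (1 : L) else 0) v), ∀ s ∈ S j, k * x j q * (s : ((cmDatum L 3 (Matrix.of fun i j : Fin 3 => if i.val + j.val + 1 = 3 then (1 : L) else 0)).Local v)) ∈ ((cmLocalIntegralLevel L 3 (Matrix.of fun i j : Fin 3 => if i.val + j.val + 1 = 3 then (1 : L) else 0) v) : Set ((cmDatum L 3 (Matrix.of fun i j : Fin 3 => if i.val + j.val + 1 = 3 then (1 : L) else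 0)).Local v)) * {x j q}) ∧
      (∀ j, j₀ ≤ j → N j * 2 ^ ((j - 2 * j₀) / 2).toNat ≤ c₃ * (S j₀).relIndex (S j)) ∧
      {y : ((cmDatum L 3 (Matrix.of fun i j : Fin 3 => if i.val + j.val + 1 = 3 then (1 : L) else 0)).Local v) | y * γ₀ * y⁻¹ ∈ C} ⊆ ⋃ j ∈ {j : ℤ | j₀ ≤ j}, ⋃ q ∈ {q : ℕ | q < N j}, ((cmLocalIntegralLevel L 3 (Matrix.of fun i j : Fin 3 => if i.val + j.val + 1 = 3 then (1 : L) else 0) v) : Set ((cmDatum L 3 (Matrix.of fun i j : Fin 3 => if i.val + j.val + 1 = 3 then (1 : L) else 0)).Local v)) * {x j q} * ((Subgroup.centralizer (({γ₀} : Set ((cmDatum L 3 (Matrix.of fun i j : Fin 3 => if i.val + j.val + 1 = 3 then (1 : L) else 0)).Local v)))) : Set ((cmDatum L 3 (Matrix.of fun i j : Fin 3 => if i.val + j.val + 1 = 3 then (1 : L) else 0)).Local v)) := by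
  classical
  -- ## 0. The frame `ψ = e` at `T = 1` and its dictionary (as in ★ p849314)
  have hT : placeForm (Matrix.of fun i j : Fin 3 => if i.val + j.val + 1 = 3 then (1 : L) else 0) w.1 = formCongr (galAdicCompletionMap (L := L) (IsCMField.complexConj L) hw) (1 : GL (Fin 3) (w.1.adicCompletion L)) ((StdForm.antidiagonal 3).over (w.1.adicCompletion L)) := by
    rw [placeForm_antidiagOne]
    simp [formCongr, Matrix.map_one]
  have hTint : (1 : GL (Fin 3) (w.1.adicCompletion L)) ∈ glInt 3 (w.1.adicCompletion L) := Subgroup.one_mem _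
  obtain ⟨ψ, hψ⟩ : ∃ ψ : ((cmDatum L 3 (Matrix.of fun i j : Fin 3 => if i.val + j.val + 1 = 3 then (1 : L) else 0)).Local v) → GL (Fin 3) (w.1.adicCompletion L), ∀ y, ψ y = 1 * ((localNonsplitEquiv (IsCMField.complexConj L) (Matrix.of fun i j : Fin 3 => if i.val + j.val + 1 = 3 then (1 : L) else 0) (IsCMField.complexConj_ne_one L) w hw y : ↥(unitaryGroupOfForm (galAdicCompletionMap (L := L) (IsCMField.complexConj L) hw) (placeForm (Matrix.of fun i j : Fin 3 => if i.val + j.val + 1 = 3 then (1 : L) else 0) w.1))) : GL (Fin 3) (w.1.adicCompletion L)) * 1⁻¹ := ⟨_, fun _ => rfl⟩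
  have hψb : ∀ y, ψ y = ((localNonsplitEquiv (IsCMField.complexConj L) (Matrix.of fun i j : Fin 3 => if i.val + j.val + 1 = 3 then (1 : L) else 0) (IsCMField.complexConj_ne_one L) w hw y : ↥(unitaryGroupOfForm (galAdicCompletionMap (L := L) (IsCMField.complexConj L) hw) (placeForm (Matrix.of fun i j : Fin 3 => if i.val + j.val + 1 = 3 then (1 : L) else 0) w.1))) : GL (Fin 3) (w.1.adicCompletion L)) := fun y => by rw [hψ, one_mul, inv_one, mul_one]
  have hψU : ∀ y, ψ y ∈ (unitaryGroupOfForm (galAdicCompletionMap (L := L) (IsCMField.complexConj L) hw) ((StdForm.antidiagonal 3).over (w.1.adicCompletion L))) := fun y => by rw [hψ]; exact conj_localNonsplitEquiv_mem L _ v w hw hT y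
  have hψmul : ∀ y y', ψ (y * y') = ψ y * ψ y' := fun y y' => by simp only [hψ]; exact conj_localNonsplitEquiv_mul L _ v w hw y y'
  have hψinv : ∀ y, ψ y⁻¹ = (ψ y)⁻¹ := fun y => by simp only [hψ]; exact conj_localNonsplitEquiv_inv L _ v w hw y
  have hψsurj : ∀ g ∈ (unitaryGroupOfForm (galAdicCompletionMap (L := L) (IsCMField.complexConj L) hw) ((StdForm.antidiagonal 3).over (w.1.adicCompletion L))), ∃ y, ψ y = g := fun g hg => by simp only [hψ]; exact exists_conj_localNonsplitEquiv_eq L _ v w hw hT hg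
  have hψK : ∀ y, y ∈ (cmLocalIntegralLevel L 3 (Matrix.of fun i j : Fin 3 => if i.val + j.val + 1 = 3 then (1 : L) else 0) v) ↔ IsIntMatrix ((ψ y : GL (Fin 3) (w.1.adicCompletion L)) : Matrix (Fin 3) (Fin 3) (w.1.adicCompletion L)) :=
    fun y => by rw [hψ]; exact mem_cmLocalIntegralLevel_iff_isIntMatrix_conj L _ v w hw hT hTint y
  have hψinj : ∀ y y', ψ y = ψ y' → y = y' := fun y y' h => by
    rw [hψ, hψ] at h; exact conj_localNonsplitEquiv_injective L _ v w hw h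
  have hψγ₀ : ((ψ γ₀ : GL (Fin 3) (w.1.adicCompletion L)) : Matrix (Fin 3) (Fin 3) (w.1.adicCompletion L)) = !![1, 1, -t₀; 0, 1, -1; 0, 0, 1] := by rw [hψb]; exact hγ₀
  -- the local field data
  haveI : Algebra.IsQuadraticExtension ↥(maximalRealSubfield L) L := IsCMField.isQuadraticExtension L
  have hσσ : ∀ x : (w.1.adicCompletion L), (galAdicCompletionMap (L := L) (IsCMField.complexConj L) hw) ((galAdicCompletionMap (L := L) (IsCMField.complexConj L) hw) x) = x :=
    galAdicCompletionMap_galAdicCompletionMap_of_smul_eq (IsCMField.complexConj L) w (IsCMField.complexConj_ne_one L) hw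
  have hvσ : ∀ x : (w.1.adicCompletion L), Valued.v ((galAdicCompletionMap (L := L) (IsCMField.complexConj L) hw) x) = Valued.v x := fun x => valued_galAdicCompletionMap (L := L) (IsCMField.complexConj L) hw x
  have h2K : (2 : (w.1.adicCompletion L)) ≠ 0 := (Valuation.ne_zero_iff _).1 (by rw [hv2]; exact WithZero.coe_ne_zero)
  haveI : Finite 𝓀[(w.1.adicCompletion L)] := finite_residueField_adicCompletion L w.1
  have hz0 : z ≠ 0 := (Valuation.ne_zero_iff _).1 (by rw [hz]; exact WithZero.coe_ne_zero)
  have hvN : Valued.v (z * (galAdicCompletionMap (L := L) (IsCMField.complexConj L) hw) z) = WithZero.exp (-2 : ℤ) := by rw [map_mul, hvσ, hz, ← WithZero.exp_add]; norm_num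
  have hN0 : z * (galAdicCompletionMap (L := L) (IsCMField.complexConj L) hw) z ≠ 0 := mul_ne_zero hz0 ((map_ne_zero _).2 hz0)
  have hσN : (galAdicCompletionMap (L := L) (IsCMField.complexConj L) hw) (z * (galAdicCompletionMap (L := L) (IsCMField.complexConj L) hw) z) = z * (galAdicCompletionMap (L := L) (IsCMField.complexConj L) hw) z := by rw [map_mul, hσσ, mul_comm]
  have hdU : d ∈ (unitaryGroupOfForm (galAdicCompletionMap (L := L) (IsCMField.complexConj L) hw) ((StdForm.antidiagonal 3).over (w.1.adicCompletion L))) := torusElt_mem_unitaryGroupOfForm (galAdicCompletionMap (L := L) (IsCMField.complexConj L) hw) hz0 (hσσ z) hd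
  obtain ⟨e, he⟩ : ∃ e : ℤ, Valued.v ξ = WithZero.exp e := by
    have h0 : Valued.v ξ ≠ 0 := (Valuation.ne_zero_iff _).2 hξ0
    obtain ⟨x, hx⟩ := WithZero.ne_zero_iff_exists.1 h0
    exact ⟨Multiplicative.toAdd x, by rw [← hx]; rfl⟩
  obtain ⟨e₂, he₂⟩ : ∃ e₂ : ℤ, e₂ = e + 2 * (c₂ : ℤ) := ⟨_, rfl⟩
  obtain ⟨τ, hτ⟩ : ∃ τ : ℤ, Valued.v t₀ ≤ WithZero.exp τ := by
    rcases eq_or_ne t₀ 0 with h0 | h0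
    · exact ⟨0, by rw [h0, map_zero]; exact zero_le⟩
    · have h0' : Valued.v t₀ ≠ 0 := (Valuation.ne_zero_iff _).2 h0
      obtain ⟨x, hx⟩ := WithZero.ne_zero_iff_exists.1 h0'
      exact ⟨Multiplicative.toAdd x, by rw [← hx]; exact le_of_eq rfl⟩
  -- ## 1. Constants of the covering
  obtain ⟨R₁, R₂, hcov'⟩ := hcov C hC
  obtain ⟨j₀, hj₀R, hj₀0⟩ : ∃ j₀ : ℤ, j₀ ≤ -R₁ ∧ j₀ ≤ 0 := ⟨min (-R₁) 0, min_le_left _ _, min_le_right _ _⟩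
  obtain ⟨r', hr'R, hr'τ, hr'j, hr'0⟩ : ∃ r' : ℤ, R₂ + c₂ ≤ r' ∧ τ - 2 * j₀ + c₂ ≤ r' ∧ -j₀ + c₂ ≤ r' ∧ 0 ≤ r' :=
    ⟨max (max (R₂ + c₂) (τ - 2 * j₀ + c₂)) (max (-j₀ + c₂) 0), le_max_of_le_left (le_max_left _ _), le_max_of_le_left (le_max_right _ _),
      le_max_of_le_right (le_max_left _ _), le_max_of_le_right (le_max_right _ _)⟩
  obtain ⟨r₂, hr₂⟩ : ∃ r₂ : ℤ, r₂ = r' + 2 * (c₂ : ℤ) := ⟨_, rfl⟩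
  -- the `κ`-bound at level `j`: `v(t₀ + 2κξ) ≤ exp(R₂ + 2j) ⇒ v(κξ) ≤ exp(r′ + 2j)` (`j ≥ j₀`)
  have hκbd : ∀ {j : ℤ} {κ : (w.1.adicCompletion L)}, j₀ ≤ j → Valued.v (t₀ + 2 * κ * ξ) ≤ WithZero.exp (R₂ + 2 * j) → Valued.v (κ * ξ) ≤ WithZero.exp (r' + 2 * j) := by
    intro j κ hj hvt
    -- `v(2κξ) ≤ max(v(t₀ + 2κξ), v t₀) ≤ exp(r′ − c₂ + 2j)` and `v(κξ) = exp(c₂) · v(2κξ)` (`v 2 = exp(−c₂)`)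
    have h2κ : Valued.v (2 * (κ * ξ)) ≤ WithZero.exp (r' - c₂ + 2 * j) := by
      rw [show 2 * (κ * ξ) = (t₀ + 2 * κ * ξ) - t₀ by ring]
      refine (Valuation.map_sub _ _ _).trans (max_le (hvt.trans (WithZero.exp_le_exp.2 (by omega))) (hτ.trans (WithZero.exp_le_exp.2 (by omega))))
    have h2κ' : Valued.v (κ * ξ) = WithZero.exp (c₂ : ℤ) * Valued.v (2 * (κ * ξ)) := by
      conv_rhs => rw [Valuation.map_mul, hv2, ← mul_assoc, ← WithZero.exp_add, add_neg_cancel, WithZero.exp_zero, one_mul]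
    rw [h2κ']
    calc WithZero.exp (c₂ : ℤ) * Valued.v (2 * (κ * ξ)) ≤ WithZero.exp (c₂ : ℤ) * WithZero.exp (r' - c₂ + 2 * j) := mul_le_mul_right h2κ _
      _ = WithZero.exp (r' + 2 * j) := by rw [← WithZero.exp_add]; congr 1; ring
  -- ## 2. The fixed line `F` and the skew line `F′`
  obtain ⟨F, hF⟩ : ∃ F : AddSubgroup (w.1.adicCompletion L), ∀ x, x ∈ F ↔ (galAdicCompletionMap (L := L) (IsCMField.complexConj L) hw) x = x :=
    ⟨{ carrier := {x | (galAdicCompletionMap (L := L) (IsCMField.complexConj L) hw) x = x}, add_mem' := fun {a b} ha hb => by simp only [Set.mem_setOf_eq] at ha hb ⊢; rw [map_add, ha, hb],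
       zero_mem' := by simp, neg_mem' := fun {a} ha => by simp only [Set.mem_setOf_eq] at ha ⊢; rw [map_neg, ha] }, fun _ => Iff.rfl⟩
  have h1F : (1 : (w.1.adicCompletion L)) ∈ F := (hF 1).2 (map_one _)
  have hNF : ∀ x ∈ F, z * (galAdicCompletionMap (L := L) (IsCMField.complexConj L) hw) z * x ∈ F := fun x hx => (hF _).2 (by rw [map_mul, hσN, (hF x).1 hx])
  have hNF' : ∀ x ∈ F, (z * (galAdicCompletionMap (L := L) (IsCMField.complexConj L) hw) z)⁻¹ * x ∈ F := fun x hx => (hF _).2 (by rw [map_mul, map_inv₀, hσN, (hF x).1 hx])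
  have hFF' : ∀ y, y ∈ (AddMonoidHom.id (w.1.adicCompletion L) + ((galAdicCompletionMap (L := L) (IsCMField.complexConj L) hw) : (w.1.adicCompletion L) →+* (w.1.adicCompletion L)).toAddMonoidHom).ker ↔ ξ⁻¹ * y ∈ F := by
    intro y
    rw [AddMonoidHom.mem_ker, hF]
    change y + (galAdicCompletionMap (L := L) (IsCMField.complexConj L) hw) y = 0 ↔ (galAdicCompletionMap (L := L) (IsCMField.complexConj L) hw) (ξ⁻¹ * y) = ξ⁻¹ * y
    rw [map_mul, map_inv₀, hξ]
    constructor
    · intro h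
      rw [show (galAdicCompletionMap (L := L) (IsCMField.complexConj L) hw) y = -y by linear_combination h, inv_neg, neg_mul_neg]
    · intro h
      -- `(−ξ)⁻¹ σy = ξ⁻¹ y` ⇒ `σ y = −y` (multiply by `−ξ`)
      have h' : (galAdicCompletionMap (L := L) (IsCMField.complexConj L) hw) y = -y := by
        have h1 : (-ξ) * ((-ξ)⁻¹ * (galAdicCompletionMap (L := L) (IsCMField.complexConj L) hw) y) = (-ξ) * (ξ⁻¹ * y) := by rw [h]
        rw [← mul_assoc, mul_inv_cancel₀ (neg_ne_zero.2 hξ0), one_mul, ← mul_assoc, neg_mul, mul_inv_cancel₀ hξ0] at h1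
        rw [h1]; ring
      rw [h']; ring
  -- ## 3. The shell counts `N j = [B_F(r₂+2j−e₂) : B_F(j−e₂)]`, `e₂ = e + 2c₂`, `r₂ = r′ + 2c₂` (same upper ball `B_F(r′+2j−e)`, lower ball shrunk by `2c₂`), and representatives
  obtain ⟨N, hNdef⟩ : ∃ N : ℤ → ℕ, ∀ j, N j = ((Valued.v : Valuation (w.1.adicCompletion L) ℤᵐ⁰).leAddSubgroup (WithZero.exp (j - e₂)) ⊓ F).relIndex ((Valued.v : Valuation (w.1.adicCompletion L) ℤᵐ⁰).leAddSubgroup (WithZero.exp (r₂ + 2 * j - e₂)) ⊓ F) := ⟨_, fun _ => rfl⟩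
  have hNne : ∀ j, N j ≠ 0 := fun j => by rw [hNdef]; exact relIndex_leAddSubgroup_inf_ne_zero F hz _ _
  have hrep : ∀ j : ℤ, ∃ κ : ℕ → (w.1.adicCompletion L), (∀ q, κ q ∈ ((Valued.v : Valuation (w.1.adicCompletion L) ℤᵐ⁰).leAddSubgroup (WithZero.exp (r₂ + 2 * j - e₂)) ⊓ F)) ∧
      ∀ b ∈ ((Valued.v : Valuation (w.1.adicCompletion L) ℤᵐ⁰).leAddSubgroup (WithZero.exp (r₂ + 2 * j - e₂)) ⊓ F), ∃ q, q < N j ∧ b - κ q ∈ ((Valued.v : Valuation (w.1.adicCompletion L) ℤᵐ⁰).leAddSubgroup (WithZero.exp (j - e₂)) ⊓ F) := by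
    intro j
    rw [hNdef]
    exact exists_rep_of_relIndex_ne_zero _ _ (relIndex_leAddSubgroup_inf_ne_zero F hz _ _)
  choose κr hκr hκr' using hrep
  have hκF : ∀ j q, (galAdicCompletionMap (L := L) (IsCMField.complexConj L) hw) (κr j q) = κr j q := fun j q => (hF _).1 (AddSubgroup.mem_inf.1 (hκr j q)).2
  have hκv : ∀ j q, Valued.v (κr j q * ξ) ≤ WithZero.exp (r' + 2 * j) := by
    intro j q
    have h := (AddSubgroup.mem_inf.1 (hκr j q)).1
    rw [Valuation.mem_leAddSubgroup_iff] at h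
    rw [map_mul, he]
    calc Valued.v (κr j q) * WithZero.exp e ≤ WithZero.exp (r₂ + 2 * j - e₂) * WithZero.exp e := mul_le_mul_left h _
      _ = WithZero.exp (r' + 2 * j) := by rw [← WithZero.exp_add]; congr 1; omega
  -- ## 4. The shell elements `x j q = ψ⁻¹(d^j · m_(κ_q))`
  have hmex : ∀ j q, ∃ m : GL (Fin 3) (w.1.adicCompletion L), (m : Matrix (Fin 3) (Fin 3) (w.1.adicCompletion L)) = !![1, κr j q * ξ, κr j q ^ 2 * ξ ^ 2 / 2; 0, 1, κr j q * ξ; 0, 0, 1] ∧ m ∈ (unitaryGroupOfForm (galAdicCompletionMap (L := L) (IsCMField.complexConj L) hw) ((StdForm.antidiagonal 3).over (w.1.adicCompletion L))) := by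
    intro j q
    obtain ⟨m, hm, -⟩ := exists_units_coe_eq_upperTriangularUnipotent (κr j q * ξ) (κr j q ^ 2 * ξ ^ 2 / 2) (κr j q * ξ)
    exact ⟨m, hm, transversal_mem (galAdicCompletionMap (L := L) (IsCMField.complexConj L) hw) hσσ h2K hξ (hκF j q) hm⟩
  choose mκ hmκ hmκU using hmex
  have hxex : ∀ j q, ∃ y : ((cmDatum L 3 (Matrix.of fun i j : Fin 3 => if i.val + j.val + 1 = 3 then (1 : L) else 0)).Local v), ψ y = d ^ j * mκ j q := fun j q => hψsurj _ (mul_mem (zpow_mem hdU j) (hmκU j q))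
  choose x hx using hxex
  -- ## 5. The level subgroups `S j = C(γ₀) ∩ ψ⁻¹(Z(U)·B_(exp(−r′), exp(2j − 2c₂)))`
  have hSex : ∀ j : ℤ, ∃ S : Subgroup ↥(Subgroup.centralizer (({γ₀} : Set ((cmDatum L 3 (Matrix.of fun i j : Fin 3 => if i.val + j.val + 1 = 3 then (1 : L) else 0)).Local v)))),
      (∀ h : ↥(Subgroup.centralizer (({γ₀} : Set ((cmDatum L 3 (Matrix.of fun i j : Fin 3 => if i.val + j.val + 1 = 3 then (1 : L) else 0)).Local v)))), h ∈ S ↔ ∃ ζ a s : (w.1.adicCompletion L), (galAdicCompletionMap (L := L) (IsCMField.complexConj L) hw) ζ * ζ = 1 ∧ (galAdicCompletionMap (L := L) (IsCMField.complexConj L) hw) a = a ∧ (galAdicCompletionMap (L := L) (IsCMField.complexConj L) hw) s = -s ∧ Valued.v a ≤ WithZero.exp (-r') ∧ Valued.v s ≤ WithZero.exp (2 * j - 2 * c₂) ∧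
        ((((localNonsplitEquiv (IsCMField.complexConj L) (Matrix.of fun i j : Fin 3 => if i.val + j.val + 1 = 3 then (1 : L) else 0) (IsCMField.complexConj_ne_one L) w hw (h : ((cmDatum L 3 (Matrix.of fun i j : Fin 3 => if i.val + j.val + 1 = 3 then (1 : L) else 0)).Local v)) : ↥(unitaryGroupOfForm (galAdicCompletionMap (L := L) (IsCMField.complexConj L) hw) (placeForm (Matrix.of fun i j : Fin 3 => if i.val + j.val + 1 = 3 then (1 : L) else 0) w.1))) : GL (Fin 3) (w.1.adicCompletion L)) : Matrix (Fin 3) (Fin 3) (w.1.adicCompletion L)) = ζ • !![1, a, s - a ^ 2 / 2; 0, 1, -a; 0, 0, 1])) ∧ IsOpen (S : Set ↥(Subgroup.centralizer (({γ₀} : Set ((cmDatum L 3 (Matrix.of fun i j : Fin 3 => if i.val + j.val + 1 = 3 then (1 : L) else 0)).Local v))))) :=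
    fun j => hballs _ _ WithZero.exp_ne_zero WithZero.exp_ne_zero
  choose S hSmem hSopen using hSex
  -- ## 6. ABSORPTION `k · x j q · s ∈ K_G · x j q` (★ FILE 1 `isIntMatrix_torusZpow_conj_transversal_conj_scalarRegCent'`, `−j + c₂ ≤ r′`)
  have habs : ∀ j, j₀ ≤ j → ∀ q, q < N j → ∀ k ∈ (cmLocalIntegralLevel L 3 (Matrix.of fun i j : Fin 3 => if i.val + j.val + 1 = 3 then (1 : L) else 0) v), ∀ s ∈ S j, k * x j q * (s : ((cmDatum L 3 (Matrix.of fun i j : Fin 3 => if i.val + j.val + 1 = 3 then (1 : L) else 0)).Local v)) ∈ ((cmLocalIntegralLevel L 3 (Matrix.of fun i j : Fin 3 => if i.val + j.val + 1 = 3 then (1 : L) else 0) v) : Set ((cmDatum L 3 (Matrix.of fun i j : Fin 3 => if i.val + j.val + 1 = 3 then (1 : L) else 0)).Local v)) * {x j q} := by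
    intro j hj q _ k hk s hs
    obtain ⟨ζ, a, s', hζ, ha, hs', hva, hvs, hrepr⟩ := (hSmem j s).1 hs
    have hψs : ((ψ (s : ((cmDatum L 3 (Matrix.of fun i j : Fin 3 => if i.val + j.val + 1 = 3 then (1 : L) else 0)).Local v)) : GL (Fin 3) (w.1.adicCompletion L)) : Matrix (Fin 3) (Fin 3) (w.1.adicCompletion L)) = ζ • !![1, a, s' - a ^ 2 / 2; 0, 1, -a; 0, 0, 1] := by rw [hψb]; exact hrepr
    have hint : x j q * (s : ((cmDatum L 3 (Matrix.of fun i j : Fin 3 => if i.val + j.val + 1 = 3 then (1 : L) else 0)).Local v)) * (x j q)⁻¹ ∈ (cmLocalIntegralLevel L 3 (Matrix.of fun i j : Fin 3 => if i.val + j.val + 1 = 3 then (1 : L) else 0) v) := by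
      rw [hψK, hψmul, hψmul, hψinv, hx]
      have hre : d ^ j * mκ j q * ψ (s : ((cmDatum L 3 (Matrix.of fun i j : Fin 3 => if i.val + j.val + 1 = 3 then (1 : L) else 0)).Local v)) * (d ^ j * mκ j q)⁻¹ = d ^ j * (mκ j q * ψ (s : ((cmDatum L 3 (Matrix.of fun i j : Fin 3 => if i.val + j.val + 1 = 3 then (1 : L) else 0)).Local v)) * (mκ j q)⁻¹) * (d ^ j)⁻¹ := by group
      rw [hre]
      exact (isIntMatrix_torusZpow_conj_transversal_conj_scalarRegCent' (galAdicCompletionMap (L := L) (IsCMField.complexConj L) hw) hvσ hv2 hz (j := j) (na := r') (r' := r') le_rfl (by omega)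
        hζ hva (hvs.trans (WithZero.exp_le_exp.2 (by omega))) (hκv j q) hd (hmκ j q) hψs).1
    exact Set.mem_mul.2 ⟨k * (x j q * (s : ((cmDatum L 3 (Matrix.of fun i j : Fin 3 => if i.val + j.val + 1 = 3 then (1 : L) else 0)).Local v)) * (x j q)⁻¹), mul_mem hk hint, x j q, Set.mem_singleton _, by group⟩
  -- ## 7. The seven clauses
  refine ⟨j₀, N, x, S, ((Valued.v : Valuation (w.1.adicCompletion L) ℤᵐ⁰).leAddSubgroup (WithZero.exp (2 * j₀ - e₂)) ⊓ F).relIndex ((Valued.v : Valuation (w.1.adicCompletion L) ℤᵐ⁰).leAddSubgroup (WithZero.exp (r₂ + 2 * j₀ - e₂)) ⊓ F), hj₀0,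
    Nat.pos_of_ne_zero (relIndex_leAddSubgroup_inf_ne_zero F hz _ _), ?_, hSopen j₀, ?_, habs, ?_, ?_⟩
  · -- COMPACTNESS of `S j`, `j ≥ j₀`: an open (hence closed) subgroup of the closed `C(γ₀)` inside the compact `x⁻¹·K_G·x` (absorption with `k = 1`, `q = 0`)
    intro j hj
    have hN0 : 0 < N j := Nat.pos_of_ne_zero (hNne j)
    have hcl : IsClosed ((S j : Subgroup ↥(Subgroup.centralizer (({γ₀} : Set ((cmDatum L 3 (Matrix.of fun i j : Fin 3 => if i.val + j.val + 1 = 3 then (1 : L) else 0)).Local v))))) : Set ↥(Subgroup.centralizer (({γ₀} : Set ((cmDatum L 3 (Matrix.of fun i j : Fin 3 => if i.val + j.val + 1 = 3 then (1 : L) else 0)).Local v))))) := (S j).isClosed_of_isOpen (hSopen j)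
    obtain ⟨hKc, -⟩ := isCompact_isOpen_cmLocalIntegralLevel L 3 (Matrix.of fun i j : Fin 3 => if i.val + j.val + 1 = 3 then (1 : L) else 0) v
    have hCc : IsCompact ((fun g : ((cmDatum L 3 (Matrix.of fun i j : Fin 3 => if i.val + j.val + 1 = 3 then (1 : L) else 0)).Local v) => (x j 0)⁻¹ * g * x j 0) '' ((cmLocalIntegralLevel L 3 (Matrix.of fun i j : Fin 3 => if i.val + j.val + 1 = 3 then (1 : L) else 0) v) : Set ((cmDatum L 3 (Matrix.of fun i j : Fin 3 => if i.val + j.val + 1 = 3 then (1 : L) else 0)).Local v))) := hKc.image (by fun_prop)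
    have hHcl : IsClosed (((Subgroup.centralizer (({γ₀} : Set ((cmDatum L 3 (Matrix.of fun i j : Fin 3 => if i.val + j.val + 1 = 3 then (1 : L) else 0)).Local v)))) : Subgroup ((cmDatum L 3 (Matrix.of fun i j : Fin 3 => if i.val + j.val + 1 = 3 then (1 : L) else 0)).Local v)) : Set ((cmDatum L 3 (Matrix.of fun i j : Fin 3 => if i.val + j.val + 1 = 3 then (1 : L) else 0)).Local v)) := isClosed_coe_centralizer_singleton γ₀
    have hpre : IsCompact ((Subtype.val : ↥(Subgroup.centralizer (({γ₀} : Set ((cmDatum L 3 (Matrix.of fun i j : Fin 3 => if i.val + j.val + 1 = 3 then (1 : L) else 0)).Local v)))) → ((cmDatum L 3 (Matrix.of fun i j : Fin 3 => if i.val + j.val + 1 = 3 then (1 : L) else 0)).Local v)) ⁻¹' ((fun g : ((cmDatum L 3 (Matrix.of fun i j : Fin 3 => if i.val + j.val + 1 = 3 then (1 : L) else 0)).Local v) => (x j 0)⁻¹ * g * x j 0) '' ((cmLocalIntegralLevel L 3 (Matrix.of fun i j : Fin 3 => if i.val + j.val + 1 = 3 then (1 : L) else 0) v) : Set ((cmDatum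 L 3 (Matrix.of fun i j : Fin 3 => if i.val + j.val + 1 = 3 then (1 : L) else 0)).Local v)))) :=
      hHcl.isClosedEmbedding_subtypeVal.isCompact_preimage hCc
    refine hpre.of_isClosed_subset hcl fun s hs => ?_
    obtain ⟨k', hk', x', hx', heq⟩ := Set.mem_mul.1 (habs j hj 0 hN0 1 (Subgroup.one_mem _) s hs)
    rw [Set.mem_singleton_iff] at hx'
    rw [hx', one_mul] at heq
    refine ⟨k', hk', ?_⟩
    show (x j 0)⁻¹ * k' * x j 0 = (s : ((cmDatum L 3 (Matrix.of fun i j : Fin 3 => if i.val + j.val + 1 = 3 then (1 : L) else 0)).Local v))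
    rw [mul_assoc, heq, ← mul_assoc, inv_mul_cancel, one_mul]
  · -- MONOTONICITY `S j₀ ≤ S j`
    intro j hj h hh
    obtain ⟨ζ, a, s, hζ, ha, hs, hva, hvs, hrepr⟩ := (hSmem j₀ h).1 hh
    exact (hSmem j h).2 ⟨ζ, a, s, hζ, ha, hs, hva, hvs.trans (WithZero.exp_le_exp.2 (by omega)), hrepr⟩
  · -- GROWTH `N j · 2^⌊(j−2j₀)∕2⌋ ≤ c₃ · [S j : S j₀]` (★ p849305 on the fixed line at `(e, r) := (e₂, r₂)`, transported from the skew line: radii `2j − 2c₂`)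
    intro j hj
    rw [hNdef, hrel (hSmem j₀) (hSmem j)]
    have htr := relIndex_leAddSubgroup_inf_eq_of_forall_mem_iff F
      (AddMonoidHom.id (w.1.adicCompletion L) + ((galAdicCompletionMap (L := L) (IsCMField.complexConj L) hw) : (w.1.adicCompletion L) →+* (w.1.adicCompletion L)).toAddMonoidHom).ker he hFF' (2 * j₀ - e₂) (2 * j - e₂)
    rw [show 2 * j₀ - e₂ + e = 2 * j₀ - 2 * c₂ by omega, show 2 * j - e₂ + e = 2 * j - 2 * c₂ by omega] at htr
    rw [htr]
    exact relIndex_mul_pow_two_le F hz hvN hNF hNF' h1F e₂ (r := r₂) (by omega) hj₀0 hj (by omega)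
  · -- COVERING: `y = k·y₁`, `ψy₁ = d^j m_κ n(a,s)`, `κ ≡ κ_q (mod B_F(j−e−2c₂))`, `m_κ = m_(κ−κ_q)·m_(κ_q)`, `d^j m_(κ−κ_q) d^(−j) ∈ K_U` (FILE 1 `…_of_le`), `ψ⁻¹n ∈ C(γ₀)`
    intro y hy
    rw [Set.mem_setOf_eq] at hy
    obtain ⟨k, y₁, j, κ, a, s, m, n, hk, hyk, hψy₁, hm, hn, hσκ, hσa, hσs, hjR, hvt⟩ := hcov' y hy
    have hj : j₀ ≤ j := by omega
    have hψy₁' : ψ y₁ = d ^ j * m * n := by rw [hψb]; exact hψy₁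
    -- `κ ∈ B_F(r′ + 2j − e) = B_F(r₂ + 2j − e₂)` and its representative `κ_q`
    have hκB : κ ∈ ((Valued.v : Valuation (w.1.adicCompletion L) ℤᵐ⁰).leAddSubgroup (WithZero.exp (r₂ + 2 * j - e₂)) ⊓ F) := by
      refine AddSubgroup.mem_inf.2 ⟨?_, (hF κ).2 hσκ⟩
      rw [Valuation.mem_leAddSubgroup_iff]
      have h1 := hκbd hj hvt
      have hvκ : Valued.v κ = Valued.v (κ * ξ) * WithZero.exp (-e) := by
        rw [map_mul, he, mul_assoc, ← WithZero.exp_add, add_neg_cancel, WithZero.exp_zero, mul_one]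
      rw [hvκ]
      calc Valued.v (κ * ξ) * WithZero.exp (-e) ≤ WithZero.exp (r' + 2 * j) * WithZero.exp (-e) := mul_le_mul_left h1 _
        _ = WithZero.exp (r₂ + 2 * j - e₂) := by rw [← WithZero.exp_add]; congr 1; omega
    obtain ⟨q, hq, hδ⟩ := hκr' j κ hκB
    obtain ⟨hδv, hδF⟩ := AddSubgroup.mem_inf.1 hδ
    rw [Valuation.mem_leAddSubgroup_iff] at hδv
    have hσδ : (galAdicCompletionMap (L := L) (IsCMField.complexConj L) hw) (κ - κr j q) = κ - κr j q := (hF _).1 hδF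
    -- the transversal element `m′ = m_(κ−κ_q)`: `m = m′ · m_(κ_q)` and `d^j m′ d^(−j)` is integral
    obtain ⟨m', hm', -⟩ := exists_units_coe_eq_upperTriangularUnipotent ((κ - κr j q) * ξ) ((κ - κr j q) ^ 2 * ξ ^ 2 / 2) ((κ - κr j q) * ξ)
    have hmm' : m = m' * mκ j q := Units.ext (by rw [hm, coe_transversal_mul h2K hm' (hmκ j q), sub_add_cancel])
    have hm'int : IsIntMatrix ((d ^ j * m' * (d ^ j)⁻¹ : GL (Fin 3) (w.1.adicCompletion L)) : Matrix (Fin 3) (Fin 3) (w.1.adicCompletion L)) := by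
      refine isIntMatrix_torusZpow_conj_transversal_of_le (galAdicCompletionMap (L := L) (IsCMField.complexConj L) hw) hvσ hv2 hz j hd hm' ?_
      rw [map_mul, he]
      calc Valued.v (κ - κr j q) * WithZero.exp e ≤ WithZero.exp (j - e₂) * WithZero.exp e := mul_le_mul_left hδv _
        _ ≤ WithZero.exp (j - c₂) := by rw [← WithZero.exp_add]; exact WithZero.exp_le_exp.2 (by omega)
    -- the centraliser element `h₀ = ψ⁻¹ n(a,s)`
    obtain ⟨hnU, hncomm⟩ := regCentElt_mem_and_commute (galAdicCompletionMap (L := L) (IsCMField.complexConj L) hw) hσσ h2K hσa hσs hψγ₀ hn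
    obtain ⟨h₀, hh₀⟩ := hψsurj n hnU
    have hh₀H : h₀ ∈ (Subgroup.centralizer (({γ₀} : Set ((cmDatum L 3 (Matrix.of fun i j : Fin 3 => if i.val + j.val + 1 = 3 then (1 : L) else 0)).Local v)))) := by
      rw [Subgroup.mem_centralizer_singleton_iff]
      apply hψinj
      rw [hψmul, hψmul, hh₀]
      exact hncomm
    -- the integral element `k″ = y₁ · h₀⁻¹ · (x j q)⁻¹`, `ψ k″ = d^j m′ d^(−j)`
    have hk'' : y₁ * h₀⁻¹ * (x j q)⁻¹ ∈ (cmLocalIntegralLevel L 3 (Matrix.of fun i j : Fin 3 => if i.val + j.val + 1 = 3 then (1 : L) else 0) v) := by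
      rw [hψK, hψmul, hψmul, hψinv, hψinv, hx, hh₀, hψy₁', hmm']
      have hre : d ^ j * (m' * mκ j q) * n * n⁻¹ * (d ^ j * mκ j q)⁻¹ = d ^ j * m' * (d ^ j)⁻¹ := by group
      rw [hre]; exact hm'int
    refine Set.mem_iUnion₂.2 ⟨j, hj, Set.mem_iUnion₂.2 ⟨q, hq, ?_⟩⟩
    refine Set.mem_mul.2 ⟨k * (y₁ * h₀⁻¹ * (x j q)⁻¹) * x j q,
      Set.mem_mul.2 ⟨k * (y₁ * h₀⁻¹ * (x j q)⁻¹), mul_mem hk hk'', x j q, Set.mem_singleton _, rfl⟩, h₀, hh₀H, ?_⟩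
    rw [hyk]; group

/-! ## §2 The hypothesis-free export at every non-split place -/

/-- = ★ `UnitaryGroup.exists_shells_of_regular_unipotent` with the hypothesis `2 ∈ 𝒪_w^×` deleted.
**THE LEVEL SHELLS OF A REGULAR UNIPOTENT ORBIT — EXPORT AT EVERY NON-SPLIT PLACE, DYADIC INCLUDED.**  For `L∕L⁺` CM, `v` a finite place of `L⁺` with `w | v` fixed by `c`
(inert or ramified, any residue characteristic), and `γ₀ ∈ G = U(Φ₃)(L⁺_v)` with `ψ γ₀ = u₀ = !![1, 1, −t₀; 0, 1, −1; 0, 0, 1]`, and every compact `C ⊆ G`: levels `j ≥ j₀`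
(`j₀ ≤ 0`), finitely many shells `K_G · x_{j,q}` per level (`q < N j`), compact level subgroups `S j ≤ C(γ₀)` increasing in `j` with `S j₀` open, ABSORPTION, GROWTH
`N j · 2^{⌊(j − 2j₀)∕2⌋} ≤ c₃ · [S j : S j₀]`, COVERING — the seven hypotheses of ★ `measure_biUnion_image_mk_mul_lt_top_of_shells'` (p849341).  Assembled from
`exists_shells_of_regular_unipotent_of_cover'` at `c₂ := ord_w 2` (★ FILE 1 `exists_valued_v_two_eq_exp`; `(2 : L_w) ≠ 0` since `L_w ⊇ ℚ`), the uniformiser `z = π_L`,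
the skew `ξ = x₀ − σx₀ ≠ 0`, the torus element `d(z)`, the COVERING (I′) ★ `exists_cover_of_regular_basePoint'` (p850048) and the CENTRALISER BALLS (II-S) ★
`exists_centralizerBall` ∕ `relIndex_centralizerBall_eq` (p849437). [cite: Rao1972, Theorem] [cite: Rogawski1990, §3.9 p. 32, §8.1 p. 112] -/
theorem UnitaryGroup.exists_shells_of_regular_unipotent'
    (L : Type) [Field L] [NumberField L] [IsCMField L] (v : HeightOneSpectrum (𝓞 ↥(maximalRealSubfield L)))
    (w : PlacesOver L v) (hw : IsCMField.complexConj L • w.1 = w.1)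
    (γ₀ : ((cmDatum L 3 (Matrix.of fun i j : Fin 3 => if i.val + j.val + 1 = 3 then (1 : L) else 0)).Local v)) {t₀ : (w.1.adicCompletion L)} (hγ₀ : (((localNonsplitEquiv (IsCMField.complexConj L) (Matrix.of fun i j : Fin 3 => if i.val + j.val + 1 = 3 then (1 : L) else 0) (IsCMField.complexConj_ne_one L) w hw γ₀ : ↥(unitaryGroupOfForm (galAdicCompletionMap (L := L) (IsCMField.complexConj L) hw) (placeForm (Matrix.of fun i j : Fin 3 => if i.val + j.val + 1 = 3 then (1 : L) else 0) w.1))) : GL (Fin 3) (w.1.adicCompletion L)) : Matrix (Fin 3) (Fin 3) (w.1.adicCompletion L)) = !![1, 1, -t₀; 0, 1, -1; 0, 0, 1])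
    (C : Set ((cmDatum L 3 (Matrix.of fun i j : Fin 3 => if i.val + j.val + 1 = 3 then (1 : L) else 0)).Local v)) (hC : IsCompact C) :
    ∃ (j₀ : ℤ) (N : ℤ → ℕ) (x : ℤ → ℕ → ((cmDatum L 3 (Matrix.of fun i j : Fin 3 => if i.val + j.val + 1 = 3 then (1 : L) else 0)).Local v)) (S : ℤ → Subgroup ↥(Subgroup.centralizer (({γ₀} : Set ((cmDatum L 3 (Matrix.of fun i j : Fin 3 => if i.val + j.val + 1 = 3 then (1 : L) else 0)).Local v))))) (c₃ : ℕ),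
      j₀ ≤ 0 ∧ 0 < c₃ ∧ (∀ j, j₀ ≤ j → IsCompact (S j : Set ↥(Subgroup.centralizer (({γ₀} : Set ((cmDatum L 3 (Matrix.of fun i j : Fin 3 => if i.val + j.val + 1 = 3 then (1 : L) else 0)).Local v)))))) ∧ IsOpen (S j₀ : Set ↥(Subgroup.centralizer (({γ₀} : Set ((cmDatum L 3 (Matrix.of fun i j : Fin 3 => if i.val + j.val + 1 = 3 then (1 : L) else 0)).Local v))))) ∧ (∀ j, j₀ ≤ j → S j₀ ≤ S j) ∧
      (∀ j, j₀ ≤ j → ∀ q, q < N j → ∀ k ∈ (cmLocalIntegralLevel L 3 (Matrix.of fun i j : Fin 3 => if i.val + j.val + 1 = 3 then (1 : L) else 0) v), ∀ s ∈ S j, k * x j q * (s : ((cmDatum L 3 (Matrix.of fun i j : Fin 3 => if i.val + j.val + 1 = 3 then (1 : L) else 0)).Local v)) ∈ ((cmLocalIntegralLevel L 3 (Matrix.of fun i j : Fin 3 => if i.val + j.val + 1 = 3 then (1 : L) else 0) v) : Set ((cmDatum L 3 (Matrix.of fun i j : Fin 3 => if i.val + j.val + 1 = 3 then (1 : L) else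 0)).Local v)) * {x j q}) ∧
      (∀ j, j₀ ≤ j → N j * 2 ^ ((j - 2 * j₀) / 2).toNat ≤ c₃ * (S j₀).relIndex (S j)) ∧
      {y : ((cmDatum L 3 (Matrix.of fun i j : Fin 3 => if i.val + j.val + 1 = 3 then (1 : L) else 0)).Local v) | y * γ₀ * y⁻¹ ∈ C} ⊆ ⋃ j ∈ {j : ℤ | j₀ ≤ j}, ⋃ q ∈ {q : ℕ | q < N j}, ((cmLocalIntegralLevel L 3 (Matrix.of fun i j : Fin 3 => if i.val + j.val + 1 = 3 then (1 : L) else 0) v) : Set ((cmDatum L 3 (Matrix.of fun i j : Fin 3 => if i.val + j.val + 1 = 3 then (1 : L) else 0)).Local v)) * {x j q} * ((Subgroup.centralizer (({γ₀} : Set ((cmDatum L 3 (Matrix.of fun i j : Fin 3 => if i.val + j.val + 1 = 3 then (1 : L) else 0)).Local v)))) : Set ((cmDatum L 3 (Matrix.of fun i j : Fin 3 => if i.val + j.val + 1 = 3 then (1 : L) else 0)).Local v)) := by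
  classical
  -- `v(2) = exp(−c₂)` for `c₂ = ord_w 2` (`2 ≠ 0` in `L_w ⊇ L ⊇ ℚ`)
  have h2K : (2 : (w.1.adicCompletion L)) ≠ 0 := by
    rw [← map_ofNat (algebraMap L (w.1.adicCompletion L)) 2]
    exact (map_ne_zero (algebraMap L (w.1.adicCompletion L))).2 two_ne_zero
  obtain ⟨c₂, hv2⟩ := exists_valued_v_two_eq_exp (K := w.1.adicCompletion L) h2K
  -- a uniformiser `z = π_L` of `L_w` (Mathlib)
  obtain ⟨πL, hπL⟩ := w.1.valuation_exists_uniformizer L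
  have hz : Valued.v ((πL : L) : (w.1.adicCompletion L)) = WithZero.exp (-1 : ℤ) := by
    rw [HeightOneSpectrum.valuedAdicCompletion_eq_valuation', hπL]
  have hz0 : ((πL : L) : (w.1.adicCompletion L)) ≠ 0 := by
    intro h
    rw [h, map_zero] at hz
    exact WithZero.exp_ne_zero hz.symm
  -- a non-zero skew element `ξ = x₀ − σ x₀` (★ `Liu2021.exists_galAdicCompletionMap_ne`: `σ_w ≠ id`)
  obtain ⟨x₀, hx₀⟩ := Literature.NumberTheory.Automorphic.Liu2021.exists_galAdicCompletionMap_ne _ L (IsCMField.complexConj L) (IsCMField.complexConj_ne_one L) hw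
  haveI : Algebra.IsQuadraticExtension ↥(maximalRealSubfield L) L := IsCMField.isQuadraticExtension L
  have hσσ : ∀ y : (w.1.adicCompletion L), (galAdicCompletionMap (L := L) (IsCMField.complexConj L) hw) ((galAdicCompletionMap (L := L) (IsCMField.complexConj L) hw) y) = y :=
    galAdicCompletionMap_galAdicCompletionMap_of_smul_eq (IsCMField.complexConj L) w (IsCMField.complexConj_ne_one L) hw
  have hξ : (galAdicCompletionMap (L := L) (IsCMField.complexConj L) hw) (x₀ - (galAdicCompletionMap (L := L) (IsCMField.complexConj L) hw) x₀) = -(x₀ - (galAdicCompletionMap (L := L) (IsCMField.complexConj L) hw) x₀) := by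
    rw [map_sub, hσσ, neg_sub]
  have hξ0 : x₀ - (galAdicCompletionMap (L := L) (IsCMField.complexConj L) hw) x₀ ≠ 0 := fun h => hx₀ (sub_eq_zero.1 h).symm
  -- the torus element `d = diag(z, 1, (σz)⁻¹)` (★ `exists_units_coe_eq_torusElt`)
  obtain ⟨d, hd, -⟩ := exists_units_coe_eq_torusElt (galAdicCompletionMap (L := L) (IsCMField.complexConj L) hw) hz0
  exact UnitaryGroup.exists_shells_of_regular_unipotent_of_cover' L v w hw hv2 hz hξ hξ0 hd γ₀ hγ₀
    (fun C hC => UnitaryGroup.exists_cover_of_regular_basePoint' L v w hw hz hξ hξ0 hd γ₀ hγ₀ C hC)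
    (fun ra r hra hr => UnitaryGroup.exists_centralizerBall L v w hw γ₀ hγ₀ ra r hra hr)
    (fun hS hS' => UnitaryGroup.relIndex_centralizerBall_eq L v w hw γ₀ hγ₀ hS hS') C hC

end Literature.NumberTheory.Rogawski1990

end
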